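import Literature.Analysis.FluidPDE.StatisticalSolution
import Literature.Analysis.FunctionSpaces.TorusVectorParseval
import Literature.Analysis.FunctionSpaces.TorusSpectralWeakDerivative
import HarnessLib

/-!
# Stationary statistical solutions on `T^d` — mean energy inequality and dissipation bound

`Literature.Analysis.FluidPDE.StatisticalSolution` vendors Foias–Manley–Rosa–Temam's notion of a
stationary statistical solution `μ` of the space-periodic Navier–Stokes equations
(`Torus.IsStationaryStatisticalSolution ν f μ`: a Borel probability measure on `H` with finite
mean enstrophy, the stationary Liouville equation, and the energy inequality on energy shells)
and records as a named fact the **mean energy inequality**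

  `Torus.IsStationaryStatisticalSolution.energy_le : ν ∫ ‖u‖²_V dμ(u) ≤ ∫ (f, u) dμ(u)`.

This file discharges it, `Torus.IsStationaryStatisticalSolution.energy_le_holds`, together with
its corollary `Torus.ensembleDissipation_le_of_isStationary` (the bound
`ε(μ) = ν ∫ ‖∇u‖² dμ ≤ |f|_{L²} (∫ |u|² dμ)^{1/2}` on the mean energy dissipation rate):
`Torus.ensembleDissipation_le_of_isStationary_holds`.

## Source and proof

C. Foias, O. Manley, R. Rosa, R. Temam, *Navier–Stokes Equations and Turbulence* (CUP 2001),
Ch. IV §1.2, Def. 1.3 (PDF p. 197 of the CUP e-book): (1.29) `∫ ‖u‖² dμ < ∞`, (1.30) the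
Liouville equation, (1.31)
`∫_{E₁ ≤ |u|² < E₂} {ν‖u‖² − (f, u)} dμ ≤ 0` for all `0 ≤ E₁ < E₂ ≤ +∞` (the vendored docstrings
number these Def. 1.2, (1.11)–(1.13)). The printed argument right after (1.31) (PDF p. 198):
on a shell `E`,
`∫_E (f, u) dμ ≤ |f| ∫_E |u| dμ ≤ |f| (∫_E |u|² dμ)^{1/2} ≤ |f| λ₁^{-1/2} (∫_E ‖u‖² dμ)^{1/2}`
by the Poincaré inequality (1.13), which is finite by (1.29); "hence, we can deduce from (1.31)
that `ν ∫_E ‖u‖² dμ ≤ ∫_E (f, u) dμ`". With `E₁ = 0`, `E₂ = +∞` the shell is all of `H` and this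
is `energy_le`.

The Lean proof follows this architecture; the work is in the two integrability statements that
make the Bochner integral in (1.31) split honestly:

* `Torus.norm_mFourierCoeff_complexify_coe_le`, `Torus.lipschitzWith_mFourierCoeff_complexify_coe`,
  `Torus.continuous_mFourierCoeff_complexify_coe` — each Fourier coefficient
  `v ↦ 𝓕(complexify ∘ v)(k)` is `1`-Lipschitz on `L²(T^d; ℝ^d)` (one term of Parseval);
* `Torus.measurable_eGradNormSq_coe` — the spectral enstrophy `u ↦ ‖∇u‖²₂ = 4π² ∑ₖ |k|² ‖û(k)‖²`
  (`Torus.eGradNormSq`) is Borel measurable on `H` (countable sum of continuous functions), so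
  that (1.29) (`enstrophy_finite`, a lower Lebesgue integral) controls the Bochner integral of
  `ν ‖u‖²_V`;
* `Torus.mFourierCoeff_complexify_coe_zero_of_mem` — fields in `H` (the closed span of the
  smooth solenoidal *mean-zero* fields) have vanishing zero mode;
* `Torus.enorm_sq_le_eGradNormSq` — the Poincaré inequality `‖u‖²_{L²} ≤ ‖∇u‖²₂` on `H`
  (`λ₁ = 4π² ≥ 1`; FMRT (1.13)), whence `∫ |u| dμ ≤ ∫ (1 + ‖∇u‖²₂) dμ < ∞` and the pairing
  `u ↦ (f, u) = ⟪u, f⟫_{L²}` (`Torus.pairing_eq_inner`, continuous on `H`) is `μ`-integrable;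
* `Torus.IsStationaryStatisticalSolution.energy_le_holds` — (1.31) with `e₁ = 0`, `e₂ = ⊤`,
  `integral_sub` and `integral_toReal`;
* `Torus.integral_le_sqrt_integral_sq` (`∫ φ dμ ≤ (∫ φ² dμ)^{1/2}` on a probability space),
  `Torus.norm_toLp_eq_sqrt`, and `Torus.ensembleDissipation_le_of_isStationary_holds` —
  `ε(μ) ≤ ∫ (f, u) dμ ≤ |f| ∫ |u| dμ ≤ |f| (∫ |u|² dμ)^{1/2}` (FMRT, loc. cit., first two steps of
  the displayed chain; Cauchy–Schwarz in `L²(T^d)` and in `L²(μ)`).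

## Mathlib / Literature search

Used: `UnitAddTorus.mFourierCoeff`, `MeasureTheory.L2.inner_def`, `MemLp.toLp`/`coeFn_toLp`,
`Lp.coeFn_sub`, `AddMonoidHom.toRealLinearMap`, `ContinuousLinearMap.isClosed_ker`,
`Submodule.topologicalClosure_minimal`, `LinearIsometry.integral_comp_comm`,
`integrable_toReal_of_lintegral_ne_top`, `integral_toReal`, `Measurable.tsum`,
`integral_mul_le_Lp_mul_Lq_of_nonneg` (Hölder), `norm_integral_le_of_norm_le`; from the
Literature `Torus.hasSum_sq_norm_mFourierCoeff_complexify`,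
`Torus.tsum_enorm_sq_mFourierCoeff_complexify`, `Torus.mFourierCoeff_congr_ae`
(`TorusVectorParseval`), `Torus.eGradNormSq_eq_tsum` (`TorusSpectralWeakDerivative`),
`Torus.mFourierCoeff_eq_integral_volume` (`TorusFourierCalculus`). The subtraction rule for
coefficients of complexified fields exists as `Torus.mFourierCoeff_complexify_sub` in
`Literature.Analysis.FluidPDE.NSHopfLimit`; it is re-proved privately here (six lines) rather
than importing that file. Nothing on measurability of spectral norms on `Lp` or on Poincaré for
the torus energy space exists in Mathlib or the Literature (searched `Poincar` — only the
Poincaré lemma / homotopy operators and Poincaré inequalities on Sobolev domains —,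
`HasZeroMean`, `eGradNormSq`: only the time-slice `Torus.aemeasurable_eGradNormSq_of_coeff`).

## References

* C. Foias, O. Manley, R. Rosa, R. Temam, *Navier–Stokes Equations and Turbulence*,
  Encyclopedia Math. Appl. 83, Cambridge Univ. Press (2001), doi:10.1017/cbo9780511546754,
  Ch. IV §1.2, Def. 1.3, (1.29)–(1.33) (PDF pp. 197–198); Ch. IV (1.13) (Poincaré). [FMRT2001]
* L. Grafakos, *Classical Fourier Analysis*, 3rd ed., GTM 249 (2014), Prop. 3.2.7 (3)
  (Parseval on `T^n`). [Grafakos2014]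
-/

noncomputable section

open MeasureTheory Filter Topology UnitAddTorus
open scoped InnerProductSpace RealInnerProductSpace ENNReal NNReal

namespace Literature.Analysis.FluidPDE

namespace Torus

variable {d : Type*} [Fintype d]

/-- Local notation for the real Hilbert space `L²(T^d; ℝ^d)`. -/
local notation "L2T " d':max => Lp (EuclideanSpace ℝ d') 2 (volume : Measure (UnitAddTorus d'))

/-- Local notation for real vector fields `T^d → ℝ^d` (the target of the `Lp` coercion). -/
local notation "Vec " d':max => UnitAddTorus d' → EuclideanSpace ℝ d'

/-! ## Fourier coefficients of `L²` vector fields: continuity in `L²` -/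

section FourierL2

/-- `∫ ‖v‖² = ‖v‖²_{L²}` for `v ∈ L²(T^d; ℝ^d)` (real Hilbert space `L²`:
`‖v‖² = ⟪v, v⟫ = ∫ ⟪v, v⟫`, Mathlib's `L2.inner_def`). [folklore] -/
theorem integral_norm_sq_coe_eq (v : L2T d) : ∫ x, ‖(v : Vec d) x‖ ^ 2 = ‖v‖ ^ 2 := by
  rw [← real_inner_self_eq_norm_sq, MeasureTheory.L2.inner_def]
  exact integral_congr_ae (ae_of_all _ fun x => (real_inner_self_eq_norm_sq _).symm)

/-- A single Fourier coefficient is bounded by the `L²` norm: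
`‖𝓕(complexify ∘ v)(k)‖ ≤ ‖v‖_{L²}` (one term of Parseval's identity; Grafakos, Prop. 3.2.7
(3)). [folklore] -/
theorem norm_mFourierCoeff_complexify_coe_le (v : L2T d) (k : d → ℤ) :
    ‖mFourierCoeff (FunctionSpaces.EuclideanSpace.complexify ∘ (v : Vec d)) k‖ ≤ ‖v‖ := by
  have h := FunctionSpaces.Torus.hasSum_sq_norm_mFourierCoeff_complexify (Lp.memLp v)
  have hk : ‖mFourierCoeff (FunctionSpaces.EuclideanSpace.complexify ∘ (v : Vec d)) k‖ ^ 2 ≤ ‖v‖ ^ 2 := by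
    rw [← integral_norm_sq_coe_eq]
    exact le_hasSum h k fun j _ => sq_nonneg _
  exact (pow_le_pow_iff_left₀ (norm_nonneg _) (norm_nonneg _) two_ne_zero).1 hk

/-- Fourier coefficients of a difference of integrable real vector fields (linearity of the
Bochner integral, global volume). The same statement is `Torus.mFourierCoeff_complexify_sub` of
`Literature.Analysis.FluidPDE.NSHopfLimit`; re-proved here to keep the imports light.
[folklore] -/
private theorem mFourierCoeff_complexify_sub_aux {v w : Vec d} (hv : Integrable v volume)
    (hw : Integrable w volume) (k : d → ℤ) :
    mFourierCoeff (FunctionSpaces.EuclideanSpace.complexify ∘ (v - w)) k =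
      mFourierCoeff (FunctionSpaces.EuclideanSpace.complexify ∘ v) k -
        mFourierCoeff (FunctionSpaces.EuclideanSpace.complexify ∘ w) k := by
  have hint : ∀ {u : Vec d}, Integrable u volume →
      Integrable (fun x => mFourier (-k) x • (FunctionSpaces.EuclideanSpace.complexify ∘ u) x) volume :=
    fun hu => (FunctionSpaces.EuclideanSpace.complexify.toContinuousLinearMap.integrable_comp hu).bdd_smul 1
      (mFourier (-k)).continuous.aestronglyMeasurable
      (Eventually.of_forall fun x => ((mFourier (-k)).norm_coe_le_norm x).trans_eq mFourier_norm)
  rw [FunctionSpaces.Torus.mFourierCoeff_eq_integral_volume, FunctionSpaces.Torus.mFourierCoeff_eq_integral_volume,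
    FunctionSpaces.Torus.mFourierCoeff_eq_integral_volume, ← integral_sub (hint hv) (hint hw)]
  refine integral_congr_ae (ae_of_all _ fun x => ?_)
  simp [smul_sub]

/-- Fourier coefficients of a difference of `L²` classes:
`𝓕(complexify ∘ (v - w))(k) = 𝓕(complexify ∘ v)(k) - 𝓕(complexify ∘ w)(k)` (the coercion of
`v - w` is a.e. the difference of the coercions, `Lp.coeFn_sub`). [folklore] -/
theorem mFourierCoeff_complexify_coe_sub (v w : L2T d) (k : d → ℤ) :
    mFourierCoeff (FunctionSpaces.EuclideanSpace.complexify ∘ ((v - w : L2T d) : Vec d)) k =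
      mFourierCoeff (FunctionSpaces.EuclideanSpace.complexify ∘ (v : Vec d)) k -
        mFourierCoeff (FunctionSpaces.EuclideanSpace.complexify ∘ (w : Vec d)) k := by
  have hae : FunctionSpaces.EuclideanSpace.complexify ∘ ((v - w : L2T d) : Vec d) =ᵐ[volume]
      FunctionSpaces.EuclideanSpace.complexify ∘ ((v : Vec d) - (w : Vec d)) :=
    (Lp.coeFn_sub v w).fun_comp FunctionSpaces.EuclideanSpace.complexify
  rw [FunctionSpaces.Torus.mFourierCoeff_congr_ae hae k]
  exact mFourierCoeff_complexify_sub_aux ((Lp.memLp v).integrable one_le_two)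
    ((Lp.memLp w).integrable one_le_two) k

/-- The Fourier coefficient maps `v ↦ 𝓕(complexify ∘ v)(k)` are `1`-Lipschitz on
`L²(T^d; ℝ^d)` (`‖𝓕(v - w)(k)‖ ≤ ‖v - w‖_{L²}`). [folklore] -/
theorem lipschitzWith_mFourierCoeff_complexify_coe (k : d → ℤ) :
    LipschitzWith 1 fun v : L2T d => mFourierCoeff (FunctionSpaces.EuclideanSpace.complexify ∘ (v : Vec d)) k :=
  LipschitzWith.of_dist_le_mul fun v w => by
    rw [NNReal.coe_one, one_mul, dist_eq_norm, dist_eq_norm, ← mFourierCoeff_complexify_coe_sub]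
    exact norm_mFourierCoeff_complexify_coe_le (v - w) k

/-- The Fourier coefficient maps `v ↦ 𝓕(complexify ∘ v)(k)` are continuous on `L²(T^d; ℝ^d)`
(bounded linear functionals; Grafakos, §3.1). [folklore] -/
theorem continuous_mFourierCoeff_complexify_coe (k : d → ℤ) :
    Continuous fun v : L2T d => mFourierCoeff (FunctionSpaces.EuclideanSpace.complexify ∘ (v : Vec d)) k :=
  (lipschitzWith_mFourierCoeff_complexify_coe k).continuous

/-- Parseval in `ℝ≥0∞` for an `L²` class: `‖v‖ₑ² = ∑' ‖𝓕(complexify ∘ v)(k)‖ₑ²`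
(Grafakos, Prop. 3.2.7 (3); `Torus.tsum_enorm_sq_mFourierCoeff_complexify`). [folklore] -/
theorem enorm_sq_coe_eq_tsum (v : L2T d) :
    ‖v‖ₑ ^ 2 = ∑' k : d → ℤ, ‖mFourierCoeff (FunctionSpaces.EuclideanSpace.complexify ∘ (v : Vec d)) k‖ₑ ^ 2 := by
  rw [FunctionSpaces.Torus.tsum_enorm_sq_mFourierCoeff_complexify (Lp.memLp v), ← ofReal_norm,
    ← ENNReal.ofReal_pow (norm_nonneg _), ← integral_norm_sq_coe_eq,
    ofReal_integral_eq_lintegral_ofReal ((Lp.memLp v).integrable_norm_pow two_ne_zero)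
      (ae_of_all _ fun x => by positivity)]
  refine lintegral_congr fun x => ?_
  rw [← ofReal_norm, ← ENNReal.ofReal_pow (norm_nonneg _)]

/-- `1 ≤ |k|²` for a nonzero integer frequency `k ∈ ℤ^d`. [folklore] -/
theorem one_le_freqNormSq {k : d → ℤ} (hk : k ≠ 0) : 1 ≤ FunctionSpaces.Torus.freqNormSq k := by
  obtain ⟨i, hi⟩ : ∃ i, k i ≠ 0 := Function.ne_iff.1 hk
  have h1 : (1 : ℝ) ≤ (k i : ℝ) ^ 2 := by
    have : (1 : ℤ) ≤ (k i) ^ 2 := by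
      have := Int.one_le_abs hi
      nlinarith [sq_abs (k i)]
    exact_mod_cast this
  exact h1.trans (Finset.single_le_sum (f := fun j => (k j : ℝ) ^ 2) (fun j _ => sq_nonneg _)
    (Finset.mem_univ i))

end FourierL2

/-! ## The energy space `H`: measurability of the enstrophy, zero mean, Poincaré -/

section EnergySpace

variable [DecidableEq d]

/-- The spectral enstrophy density `u ↦ ‖∇u‖²₂ = 4π² ∑ₖ |k|² ‖û(k)‖²` (`Torus.eGradNormSq` of
the representative of `u ∈ H`) is Borel measurable on `H`: a countable sum of continuous
functions of `u`. [folklore] -/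
theorem measurable_eGradNormSq_coe :
    Measurable fun u : FunctionSpaces.Torus.energySpace d => FunctionSpaces.Torus.eGradNormSq ((u : L2T d) : Vec d) := by
  have h : (fun u : FunctionSpaces.Torus.energySpace d => FunctionSpaces.Torus.eGradNormSq ((u : L2T d) : Vec d)) =
      fun u : FunctionSpaces.Torus.energySpace d => ENNReal.ofReal (4 * Real.pi ^ 2) * ∑' k : d → ℤ,
        ENNReal.ofReal (FunctionSpaces.Torus.freqNormSq k) *
          ‖mFourierCoeff (FunctionSpaces.EuclideanSpace.complexify ∘ ((u : L2T d) : Vec d)) k‖ₑ ^ 2 :=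
    funext fun u => FunctionSpaces.Torus.eGradNormSq_eq_tsum _
  rw [h]
  refine Measurable.const_mul (Measurable.tsum fun k => Measurable.const_mul ?_ _) _
  exact ((continuous_mFourierCoeff_complexify_coe k).comp
    continuous_subtype_val).measurable.enorm.pow_const 2

/-- The zero mode of a field in `H` vanishes: `𝓕(complexify ∘ v)(0) = 0` for `v ∈ H`. The
smooth solenoidal generators `𝒱` of `H` have zero mean (`Torus.HasZeroMean`, i.e. vanishing
zero coefficient), and the zero coefficient is a continuous additive — hence real-linear —
map `L² → ℂ^d`, whose kernel is a closed subspace containing `𝒱`, hence containing the closed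
span `H` (Constantin–Foias 1988, Ch. 4: `H` is mean-zero). [folklore] -/
theorem mFourierCoeff_complexify_coe_zero_of_mem {v : L2T d} (hv : v ∈ FunctionSpaces.Torus.energySpace d) :
    mFourierCoeff (FunctionSpaces.EuclideanSpace.complexify ∘ (v : Vec d)) 0 = 0 := by
  -- the zero coefficient as a continuous real-linear map `L² → ℂ^d`
  set c : L2T d → EuclideanSpace ℂ d := fun v =>
    mFourierCoeff (FunctionSpaces.EuclideanSpace.complexify ∘ (v : Vec d)) 0 with hc
  have hsub : ∀ v w : L2T d, c (v - w) = c v - c w := fun v w =>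
    mFourierCoeff_complexify_coe_sub v w 0
  have hzero : c 0 = 0 := by simpa using hsub 0 0
  let C : L2T d →+ EuclideanSpace ℂ d :=
    { toFun := c
      map_zero' := hzero
      map_add' := fun v w => by
        have h := hsub (v + w) w
        rw [add_sub_cancel_right] at h
        rw [h, sub_add_cancel] }
  let Cℝ : L2T d →L[ℝ] EuclideanSpace ℂ d :=
    C.toRealLinearMap (continuous_mFourierCoeff_complexify_coe 0)
  -- the generators have zero mean: `𝓕(complexify ∘ g)(0) = complexify (∫ g) = 0`
  have hgen : ∀ w ∈ FunctionSpaces.Torus.smoothSolenoidal d, c w = 0 := by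
    rintro w ⟨g, -, -, hmean, hae⟩
    simp only [hc]
    rw [FunctionSpaces.Torus.mFourierCoeff_congr_ae (hae.fun_comp FunctionSpaces.EuclideanSpace.complexify) 0,
      FunctionSpaces.Torus.mFourierCoeff_eq_integral_volume]
    simp only [neg_zero, mFourier_zero, ContinuousMap.one_apply, one_smul, Function.comp_apply]
    rw [FunctionSpaces.EuclideanSpace.complexify.integral_comp_comm g, hmean, map_zero]
  -- hence so does every element of the closed span `H`
  have hle : (Submodule.span ℝ (FunctionSpaces.Torus.smoothSolenoidal d)).topologicalClosure ≤
      LinearMap.ker (Cℝ : L2T d →ₗ[ℝ] EuclideanSpace ℂ d) := by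
    refine (Submodule.span ℝ (FunctionSpaces.Torus.smoothSolenoidal d)).topologicalClosure_minimal ?_ Cℝ.isClosed_ker
    refine Submodule.span_le.2 fun w hw => ?_
    show Cℝ w = 0
    exact hgen w hw
  exact hle hv

/-- **Poincaré inequality on `H`** (spectral form, first eigenvalue `λ₁ = 4π² ≥ 1` of the
Stokes operator on the unit torus): `‖u‖²_{L²} ≤ ‖∇u‖²₂` for every `u ∈ H` — the zero mode
vanishes (`Torus.mFourierCoeff_complexify_coe_zero_of_mem`) and `|k|² ≥ 1` at the other modes
(FMRT 2001, Ch. IV (1.13): `λ₁^{1/2} |u| ≤ ‖u‖` on `V`; here with the non-sharp constant `1`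
and in `ℝ≥0∞`, so that no finiteness hypothesis is needed). [folklore] -/
theorem enorm_sq_le_eGradNormSq (u : FunctionSpaces.Torus.energySpace d) :
    ‖u‖ₑ ^ 2 ≤ FunctionSpaces.Torus.eGradNormSq ((u : L2T d) : Vec d) := by
  have h0 := mFourierCoeff_complexify_coe_zero_of_mem u.2
  have hn : ‖u‖ₑ = ‖(u : L2T d)‖ₑ := rfl
  rw [hn, enorm_sq_coe_eq_tsum, FunctionSpaces.Torus.eGradNormSq_eq_tsum]
  calc ∑' k : d → ℤ, ‖mFourierCoeff (FunctionSpaces.EuclideanSpace.complexify ∘ ((u : L2T d) : Vec d)) k‖ₑ ^ 2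
      ≤ ∑' k : d → ℤ, ENNReal.ofReal (FunctionSpaces.Torus.freqNormSq k) *
          ‖mFourierCoeff (FunctionSpaces.EuclideanSpace.complexify ∘ ((u : L2T d) : Vec d)) k‖ₑ ^ 2 := by
        refine ENNReal.tsum_le_tsum fun k => ?_
        by_cases hk : k = 0
        · subst hk
          simp [h0]
        · exact le_mul_of_one_le_left zero_le (ENNReal.one_le_ofReal.2 (one_le_freqNormSq hk))
    _ ≤ ENNReal.ofReal (4 * Real.pi ^ 2) * ∑' k : d → ℤ, ENNReal.ofReal (FunctionSpaces.Torus.freqNormSq k) *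
          ‖mFourierCoeff (FunctionSpaces.EuclideanSpace.complexify ∘ ((u : L2T d) : Vec d)) k‖ₑ ^ 2 := by
        refine le_mul_of_one_le_left zero_le (ENNReal.one_le_ofReal.2 ?_)
        nlinarith [Real.two_le_pi, Real.pi_pos]

end EnergySpace

/-! ## The mean energy inequality -/

section EnergyLe

variable [DecidableEq d]

omit [DecidableEq d] in
/-- The pairing `(v, f) = ∫ ⟪v, f⟫` of an `L²` class with an `L²` field is the `L²` inner
product with the class of `f` (`Torus.pairing`, Mathlib's `L2.inner_def`,
`MemLp.coeFn_toLp`). [folklore] -/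
theorem pairing_eq_inner {f : Vec d} (hf : MemLp f 2 volume) (v : L2T d) :
    pairing v f = ⟪v, hf.toLp f⟫ := by
  rw [MeasureTheory.L2.inner_def, pairing]
  refine integral_congr_ae ?_
  filter_upwards [hf.coeFn_toLp] with x hx
  rw [hx]

omit [Fintype d] [DecidableEq d] in
/-- An extended nonnegative real is at most one plus its square. [folklore] -/
private theorem ennreal_le_one_add_sq (a : ℝ≥0∞) : a ≤ 1 + a ^ 2 := by
  rcases le_total a 1 with h | h
  · exact h.trans le_self_add
  · calc a = a * 1 := (mul_one a).symm
      _ ≤ a * a := by gcongr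
      _ = a ^ 2 := (sq a).symm
      _ ≤ 1 + a ^ 2 := le_add_self

/-- **Mean energy inequality of a stationary statistical solution** (discharge of the named fact
`Torus.IsStationaryStatisticalSolution.energy_le`): if `μ` is a stationary statistical solution
with viscosity `ν` and force `f ∈ L²`, then `ν ∫ ‖u‖²_V dμ(u) ≤ ∫ (f, u) dμ(u)` (Foias–Manley–
Rosa–Temam 2001, Ch. IV §1.2, the inequality displayed after (1.31), PDF p. 198, with `E₁ = 0`,
`E₂ = +∞`). Proof as printed there: the shell energy inequality (1.31) (`energy_ineq 0 ⊤`) is an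
inequality for `∫ (ν ‖u‖²_V − (f, u)) dμ` over all of `H`; both summands are `μ`-integrable —
`ν ‖u‖²_V` by the finite mean enstrophy (1.29) (`enstrophy_finite`) and measurability of the
spectral enstrophy on `H` (`Torus.measurable_eGradNormSq_coe`), and `(f, u) = ⟪u, f⟫_{L²}`
(continuous in `u`) by `|(f, u)| ≤ |f| |u| ≤ |f| (1 + ‖u‖²_V)` (Cauchy–Schwarz and the Poincaré
inequality (1.13), `Torus.enorm_sq_le_eGradNormSq`) and (1.29) again — so the integral
splits. [cite: FMRT2001, Ch. IV §1.2 Def. 1.3 (1.29)–(1.31), display after (1.31)] -/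
theorem IsStationaryStatisticalSolution.energy_le_holds :
    IsStationaryStatisticalSolution.energy_le (d := d) := by
  intro ν f μ hμ hf
  haveI := hμ.prob
  -- the enstrophy density and its integrability ((1.29))
  set G : FunctionSpaces.Torus.energySpace d → ℝ≥0∞ := fun u => FunctionSpaces.Torus.eGradNormSq ((u : L2T d) : Vec d) with hG
  have hGm : Measurable G := measurable_eGradNormSq_coe
  have hGfin : ∫⁻ u, G u ∂μ < ∞ := hμ.enstrophy_finite
  have hGlt : ∀ᵐ u ∂μ, G u < ∞ := ae_lt_top hGm hGfin.ne
  have hA : Integrable (fun u => (G u).toReal) μ :=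
    integrable_toReal_of_lintegral_ne_top hGm.aemeasurable hGfin.ne
  -- the pairing `(f, u)` is `μ`-integrable (Poincaré and (1.29))
  set g : L2T d := hf.toLp f with hg
  have hpair : (fun u : FunctionSpaces.Torus.energySpace d => pairing (u : L2T d) f) =
      fun u : FunctionSpaces.Torus.energySpace d => ⟪(u : L2T d), g⟫ := funext fun u => pairing_eq_inner hf _
  have hBm : AEStronglyMeasurable (fun u : FunctionSpaces.Torus.energySpace d => pairing (u : L2T d) f) μ := by
    rw [hpair]
    exact (continuous_subtype_val.inner continuous_const).aestronglyMeasurable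
  have hnorm_fin : ∫⁻ u : FunctionSpaces.Torus.energySpace d, ‖u‖ₑ ∂μ < ∞ := by
    calc ∫⁻ u : FunctionSpaces.Torus.energySpace d, ‖u‖ₑ ∂μ ≤ ∫⁻ u, (1 + G u) ∂μ :=
          lintegral_mono fun u => (ennreal_le_one_add_sq _).trans (by
            gcongr
            exact enorm_sq_le_eGradNormSq u)
      _ = ∫⁻ _ : FunctionSpaces.Torus.energySpace d, (1 : ℝ≥0∞) ∂μ + ∫⁻ u, G u ∂μ :=
          lintegral_add_left measurable_const _
      _ < ∞ := by
          rw [lintegral_const, measure_univ, mul_one]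
          exact ENNReal.add_lt_top.2 ⟨ENNReal.one_lt_top, hGfin⟩
  have hnorm_int : Integrable (fun u : FunctionSpaces.Torus.energySpace d => ‖u‖) μ := by
    refine ⟨continuous_norm.aestronglyMeasurable, ?_⟩
    show ∫⁻ u : FunctionSpaces.Torus.energySpace d, ‖‖u‖‖ₑ ∂μ < ∞
    simpa only [enorm_norm] using hnorm_fin
  have hB : Integrable (fun u : FunctionSpaces.Torus.energySpace d => pairing (u : L2T d) f) μ := by
    refine Integrable.mono' (hnorm_int.mul_const ‖g‖) hBm (ae_of_all _ fun u => ?_)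
    rw [pairing_eq_inner hf, Real.norm_eq_abs]
    exact (abs_real_inner_le_norm _ _).trans_eq (by rw [Submodule.coe_norm])
  -- the shell energy inequality (1.31) with `e₁ = 0`, `e₂ = ∞` is over all of `H`
  have hshell := hμ.energy_ineq 0 ⊤ (by simp)
  have hset : {u : FunctionSpaces.Torus.energySpace d | (0 : ℝ≥0∞) ≤ ‖u‖ₑ ^ 2 ∧ ‖u‖ₑ ^ 2 < ⊤} = Set.univ :=
    Set.eq_univ_of_forall fun u => ⟨zero_le, ENNReal.pow_lt_top enorm_lt_top⟩
  rw [hset, Measure.restrict_univ] at hshell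
  -- split the integral: `ν ∫ ‖u‖²_V dμ - ∫ (f, u) dμ ≤ 0`
  have hsplit : ∫ u, (ν * (G u).toReal - pairing (u : L2T d) f) ∂μ =
      ν * (∫⁻ u, G u ∂μ).toReal - ∫ u, pairing (u : L2T d) f ∂μ := by
    rw [integral_sub (hA.const_mul ν) hB, integral_const_mul, integral_toReal hGm.aemeasurable hGlt]
  rw [hsplit, sub_nonpos] at hshell
  exact hshell

end EnergyLe

/-! ## The bound on the mean energy dissipation rate -/

section Dissipation

variable [DecidableEq d]

omit [Fintype d] [DecidableEq d] in
/-- On a probability space, `∫ φ ≤ (∫ φ²)^{1/2}` for a nonnegative `φ` with `φ² ∈ L¹`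
(Cauchy–Schwarz / Jensen; Mathlib's `integral_mul_le_Lp_mul_Lq_of_nonneg` with `p = q = 2`
against the constant `1`). [folklore] -/
theorem integral_le_sqrt_integral_sq {α : Type*} [MeasurableSpace α] {μ : Measure α}
    [IsProbabilityMeasure μ] {φ : α → ℝ} (hφ : 0 ≤ᵐ[μ] φ) (hφm : AEStronglyMeasurable φ μ)
    (h2 : Integrable (fun a => φ a ^ 2) μ) :
    ∫ a, φ a ∂μ ≤ Real.sqrt (∫ a, φ a ^ 2 ∂μ) := by
  have hp : MemLp φ (ENNReal.ofReal 2) μ := by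
    rw [ENNReal.ofReal_ofNat]
    exact (memLp_two_iff_integrable_sq hφm).2 h2
  have h := integral_mul_le_Lp_mul_Lq_of_nonneg (μ := μ) Real.HolderConjugate.two_two hφ
    (ae_of_all _ fun _ => zero_le_one) hp (memLp_const 1)
  simp only [mul_one, integral_const, probReal_univ, smul_eq_mul, Real.one_rpow] at h
  simpa only [Real.sqrt_eq_rpow, Real.rpow_two, one_div] using h

omit [DecidableEq d] in
/-- The `L²` norm of the class of `f` is `(∫ ‖f‖²)^{1/2}`. [folklore] -/
theorem norm_toLp_eq_sqrt {f : Vec d} (hf : MemLp f 2 volume) :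
    ‖hf.toLp f‖ = Real.sqrt (∫ x, ‖f x‖ ^ 2) := by
  rw [← Real.sqrt_sq (norm_nonneg _), ← real_inner_self_eq_norm_sq, MeasureTheory.L2.inner_def]
  congr 1
  refine integral_congr_ae ?_
  filter_upwards [hf.coeFn_toLp] with x hx
  rw [hx, real_inner_self_eq_norm_sq]

/-- **Bound on the mean energy dissipation rate** (discharge of the named fact
`Torus.ensembleDissipation_le_of_isStationary`): for a stationary statistical solution `μ` with
force `f ∈ L²` and finite mean energy, `ε(μ) = ν ∫ ‖∇u‖² dμ ≤ |f| (∫ |u|² dμ)^{1/2}` — the mean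
energy inequality `energy_le_holds` followed by `∫ (f, u) dμ ≤ |f| ∫ |u| dμ ≤ |f| (∫ |u|² dμ)^{1/2}`
(Cauchy–Schwarz in `L²(T^d)` and in `L²(μ)`), the first two steps of the chain displayed after
(1.31) in Foias–Manley–Rosa–Temam 2001, Ch. IV §1.2 (PDF p. 198), cf. (1.32)–(1.33) and the
mean energy `e(μ)` of (1.15)/Ch. V §1.
[cite: FMRT2001, Ch. IV §1.2, display after (1.31); (1.32)–(1.33)] -/
theorem ensembleDissipation_le_of_isStationary_holds :
    ensembleDissipation_le_of_isStationary (d := d) := by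
  intro ν f μ hμ hf hE
  haveI := hμ.prob
  set g : L2T d := hf.toLp f with hg
  -- `∫ |u| dμ` is finite and at most `(∫ |u|² dμ)^{1/2}`
  have hnorm2 : MemLp (fun u : FunctionSpaces.Torus.energySpace d => ‖u‖) 2 μ :=
    (memLp_two_iff_integrable_sq continuous_norm.aestronglyMeasurable).2 hE
  have hnorm_int : Integrable (fun u : FunctionSpaces.Torus.energySpace d => ‖u‖) μ := hnorm2.integrable one_le_two
  have hCS : ∫ u : FunctionSpaces.Torus.energySpace d, ‖u‖ ∂μ ≤ Real.sqrt (ensembleEnergy μ) :=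
    integral_le_sqrt_integral_sq (ae_of_all _ fun u => norm_nonneg u)
      continuous_norm.aestronglyMeasurable hE
  -- `∫ (f, u) dμ ≤ |f| ∫ |u| dμ`
  have hfu : ∫ u, pairing (u : L2T d) f ∂μ ≤ ‖g‖ * ∫ u : FunctionSpaces.Torus.energySpace d, ‖u‖ ∂μ := by
    calc ∫ u, pairing (u : L2T d) f ∂μ ≤ ‖∫ u, pairing (u : L2T d) f ∂μ‖ := Real.le_norm_self _
      _ ≤ ∫ u : FunctionSpaces.Torus.energySpace d, ‖g‖ * ‖u‖ ∂μ :=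
          norm_integral_le_of_norm_le (hnorm_int.const_mul ‖g‖) (ae_of_all _ fun u => by
            rw [pairing_eq_inner hf, Real.norm_eq_abs, mul_comm]
            exact (abs_real_inner_le_norm _ _).trans_eq (by rw [Submodule.coe_norm]))
      _ = ‖g‖ * ∫ u : FunctionSpaces.Torus.energySpace d, ‖u‖ ∂μ := integral_const_mul _ _
  calc ensembleDissipation ν μ ≤ ∫ u, pairing (u : L2T d) f ∂μ :=
        IsStationaryStatisticalSolution.energy_le_holds hμ hf
    _ ≤ ‖g‖ * ∫ u : FunctionSpaces.Torus.energySpace d, ‖u‖ ∂μ := hfu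
    _ ≤ ‖g‖ * Real.sqrt (ensembleEnergy μ) := mul_le_mul_of_nonneg_left hCS (norm_nonneg _)
    _ = Real.sqrt (∫ x, ‖f x‖ ^ 2) * Real.sqrt (ensembleEnergy μ) := by
        rw [hg, norm_toLp_eq_sqrt hf]

end Dissipation

end Torus

end Literature.Analysis.FluidPDE
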